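import Mathlib
import HarnessLib
import Summits.Parity.GeneralizedHardyLittlewood.Theses.LeeYangFibres
import Summits.Parity.GeneralizedHardyLittlewood.Theorems.LeeYangFibresModelHyperbolicity
import Summits.Parity.GeneralizedHardyLittlewood.Theorems.LeeYangFibresFibreHyperbolicityDefs
import Summits.Parity.GeneralizedHardyLittlewood.Theorems.LeeYangFibresFibreHyperbolicityCoeffBound
import Summits.Parity.GeneralizedHardyLittlewood.Theorems.LeeYangFibresFibreHyperbolicityPerturb
import Summits.Parity.GeneralizedHardyLittlewood.Theorems.LeeYangFibresFibreHyperbolicityAPCells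
import Summits.Parity.GeneralizedHardyLittlewood.Theorems.LeeYangFibresFibreHyperbolicityAssemble
import Summits.Parity.GeneralizedHardyLittlewood.Theorems.LeeYangFibresFibreHyperbolicityGhostFree
import Summits.Parity.GeneralizedHardyLittlewood.Theorems.LeeYangFibresFibreHyperbolicityLawOneAnalytic
import Summits.Parity.GeneralizedHardyLittlewood.Theorems.LeeYangFibresFibreHyperbolicityLawOneNorm
import Summits.Parity.GeneralizedHardyLittlewood.Theorems.LeeYangFibresFibreHyperbolicityGhostFreeOne
import Summits.Parity.GeneralizedHardyLittlewood.Theorems.LeeYangFibresFibreHyperbolicityResidue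

/-!
# Crux `FibreHyperbolicity` (stmt-Parity-14108) — line `SketchIdeator1`, reshaped: MODEL TRANSFER (skeleton v7)

v7 = v6 with its five proved stubs LANDED and imported (`…GhostFreeOne.lean` p96356: `stub_ghostFreeOne`; `…Residue.lean` p96741:
`stub_residueCrux/Law/Cells/DimOne`, `ghostFree_all`, `fibreHyperbolicityAt_of_ghostFree`); the ONLY `sorry` is `stub_ghostFree`.

v6 (continuation lead `prover-line-stmt-Parity-14108-1`, 2026-08-16): the composition now runs UNIFORMLY through the
ghost-free cell law `GhostFreeCellLaw t` at every `t ≥ 1` — new registered stub `stub_ghostFreeOne : GhostFreeCellLaw 1`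
(parity-free; PROVED in the lead's folder from the `CellParityLaw` line's landed base law, landing as
`Theorems/LeeYangFibresFibreHyperbolicityGhostFreeOne.lean`) next to the open `stub_ghostFree` (`t ≥ 2`) — and the
skeleton REGISTERS what the open stub carries: `stub_residueCrux/Law/Cells/DimOne`, the implications from
`∀ t ≥ 2, GhostFreeCellLaw t` to `FibreHyperbolicity`, `CellParityLaw`, `PrimeCellsRelative` and `RelativeDimOne`
(all four PROVED in the lead's folder, landing as `Theorems/LeeYangFibresFibreHyperbolicityResidue.lean`). The last
open stub of the line therefore contains the route's own output node; see `residue_carries_route` below.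

Skeleton of the line lead (`prover-line-stmt-Parity-14108-0`). The ideator sketch `SketchIdeator1.lean`
(cards brenti-shadow / buchstab-pencil-compatibility / hankel-dip-ladder) is reshaped into the one
composition every card and the refuter's HL-world reduction agree on:

  FibreHyperbolicity ⇐ [joint rough Ω-cells follow the independent model, coefficientwise, relative
  accuracy ε, cofinally/for all u]  +  [the model polynomial `Σ_{m<u} I_{m+1}(u) X^m` has `u-2` SIMPLE real
  zeros — PROVED in the tree (`WindowChainTransport.stub_simpleZeros`)]  +  [a Hurwitz/IVT perturbation
  lemma]  +  [fibre bookkeeping].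

Stubs (registered on stmt-Parity-14108; v7: every registered stub LANDED except the open residue `stub_ghostFree`, the only `sorry`; status 2026-08-16T11:25Z):
* `stub_perturb : PerturbLemma` — LANDED (p86826, `Theorems/…Perturb.lean`): simple real zeros survive an
  ε-perturbation of degree ≤ deg+1 (Hurwitz by IVT + root-count parity; pure Mathlib).
* `stub_coeffBound : CoeffBound` — LANDED (p86706, `…CoeffBound.lean`): a cell law relative to the model densities
  gives fibre coefficients `p_m = Λ' I_m (1 ± 2^{t-1} ε)` and a top coefficient `0 ≤ p_u ≤ 2^{t-1} ε Λ'`.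
* `fibreExpand : FibreExpansion` — LANDED in the Defs file (p86687): the fibre sum regrouped by the free exponent.
* `stub_apCells : APCellAsymptotic` — LANDED (p87665, `…APCells.lean`): Alladi's Ω-cell asymptotic for rough integers
  in a FIXED RESIDUE CLASS (differences of classes by induction on Ω over Buchstab-in-classes + class total
  `CellRate`; parity-free).
* `stub_lawOneAnalytic : APCellAsymptotic → SegmentLawOne` — LANDED (p89990, `…LawOneAnalytic.lean` + helpers
  `…LawOneAnalyticAux.lean` p88391): the segment law (continuity of the densities, threshold `⌊N^{1/u}⌋₊+1`).
* `stub_lawOneNorm : SegmentLawOne → CellModelLaw 1` — LANDED (p90297, `…LawOneNorm.lean` + helpers `…LawOneNormGT.lean`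
  p87965): Green–Tao normalisations `β_∞ = |K ∩ {ψ > 0}|`, `𝔖 = |a|/φ(|a|)·[(a,b)=1]`, `n ↦ a n + b` onto a class of a segment.
* `stub_ghostFree : ∀ t ≥ 2, GhostFreeCellLaw t` — OPEN, THE ARITHMETIC RESIDUE in the route's currency: crux 3
  `CellParityLaw` with all ghosts `θ_S = 0` (`S ≠ ∅`). Hardy–Littlewood strength (contains Dickson–HL for rough
  prime tuples); given `CellParityLaw` it IS the vanishing of the ghosts, hence (by `HyperbolicityClipsParity`)
  equivalent to the crux itself. Not attacked.
* `stub_ghostBridge : ∀ t, GhostFreeCellLaw t → CellModelLaw t` — LANDED (p88589, `…GhostFree.lean`;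
  Alladi asymptotics `A_m(N) log N/N → I_m(u)`, `A_u(N) = 0`); `stub_lawMany := stub_ghostBridge ∘ stub_ghostFree`.
* `stub_assemble` — LANDED (p88012, `…Assemble.lean`): law + model simplicity (`stub_simpleZeros`) + perturbation +
  bookkeeping ⇒ `FHAt t`, at `u := max u₀ 2`.

`FibreHyperbolicity_of` concludes the crux BY NAME (`crux_iff`); the crux is CLOSED MODULO `stub_ghostFree`.
The `t = 1` case (`fibreHyperbolicityAt_one : FHAt 1`) is unconditional (all its stubs are landed) and lands as
`Theorems/LeeYangFibresFibreHyperbolicityAtOne.lean`.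
The `t = 1` case of the crux follows from the provable stubs alone (`fibreHyperbolicityAt_one`).
-/

noncomputable section

namespace Summit.Parity.GeneralizedHardyLittlewood.Cruxes.FibreHyperbolicity.ModelTransfer

open scoped BigOperators Classical
open Finset Polynomial
open Literature.NumberTheory.Sieve
open Summit.Parity.GeneralizedHardyLittlewood.Theses.LeeYangFibres (FibreHyperbolicity)
open Summit.Parity.GeneralizedHardyLittlewood.Cruxes.ModelHyperbolicity.WindowChainTransport (cellDensity)

/-! ## Objects and statements

LANDED as `Theorems/LeeYangFibresFibreHyperbolicityDefs.lean` (p86687, imported): `jointCell`, `fibre`, `FHAt`,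
`crux_iff`, `CellModelLaw`, `PerturbLemma`, `CoeffBound`, `FibreExpansion` (+ the proved registered stub
`fibreExpand`), `APCellAsymptotic`, `SegmentLawOne`. -/

/-! ## Registered stubs

Worker stubs are stated in UNFOLDED form (plain Mathlib / Literature / `cellDensity` vocabulary) so that each
lands as a pure proof file; `stub_perturb : PerturbLemma`, `stub_coeffBound : CoeffBound`,
`stub_apCells : APCellAsymptotic`, `stub_lawOneAnalytic : APCellAsymptotic → SegmentLawOne`,
`stub_lawOneNorm : SegmentLawOne → CellModelLaw 1`
hold definitionally (see `FibreHyperbolicity_of`). -/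

-- `stub_perturb : PerturbLemma` (unfolded) LANDED: Theorems/LeeYangFibresFibreHyperbolicityPerturb.lean (p86826), imported.
-- `stub_coeffBound : CoeffBound` (unfolded) LANDED: Theorems/LeeYangFibresFibreHyperbolicityCoeffBound.lean (p86706), imported.

-- `fibreExpand : FibreExpansion` LANDED in the Defs file (p86687).

-- `stub_apCells : APCellAsymptotic` (unfolded) LANDED: Theorems/LeeYangFibresFibreHyperbolicityAPCells.lean (p87665), imported.

-- `stub_lawOneAnalytic : APCellAsymptotic → SegmentLawOne` (unfolded) LANDED: Theorems/LeeYangFibresFibreHyperbolicityLawOneAnalytic.lean (p89990), imported.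

-- `stub_lawOneNorm : SegmentLawOne → CellModelLaw 1` (unfolded) LANDED: Theorems/LeeYangFibresFibreHyperbolicityLawOneNorm.lean (p90297), imported.

-- `def GhostFreeCellLaw` and `stub_ghostBridge : ∀ t, GhostFreeCellLaw t → CellModelLaw t` LANDED:
-- Theorems/LeeYangFibresFibreHyperbolicityGhostFree.lean (p88589), imported.

-- `stub_ghostFreeOne : GhostFreeCellLaw 1` (v6 stub, parity-free) LANDED: Theorems/LeeYangFibresFibreHyperbolicityGhostFreeOne.lean (p96356), imported.

/-- Stub (OPEN-PROBLEM STRENGTH — the arithmetic residue of the crux, in the route's currency): the ghost-free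
cell law for `t ≥ 2` forms = crux 3 `CellParityLaw` with every parity amplitude `θ_S` (`S ≠ ∅`) equal to `0`.
Hardy–Littlewood strength (contains `C_{(1,…,1)} ~ β_∞ 𝔖 (A_1(N)/N)^t`, i.e. Dickson–Hardy–Littlewood for rough prime
tuples, and the almost-prime twin cells); by the LANDED residue statements `stub_residueCells/DimOne` it implies the
route's OUTPUT nodes `PrimeCellsRelative` and `RelativeDimOne` outright (`residue_carries_route`). Not claimed provable;
isolated so that everything else in the line is proved and landed. -/
theorem stub_ghostFree : ∀ t : ℕ, 2 ≤ t → GhostFreeCellLaw t := by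
  sorry

-- Registered residue statements `stub_residueCrux/Law/Cells/DimOne` (v6) LANDED:
-- Theorems/LeeYangFibresFibreHyperbolicityResidue.lean (p96741), imported (with `ghostFree_all`, `fibreHyperbolicityAt_of_ghostFree`).

/-- The former registered stub `stub_lawMany`, now a composition: `stub_ghostBridge ∘ stub_ghostFree`. -/
theorem stub_lawMany : ∀ t : ℕ, 2 ≤ t → CellModelLaw t :=
  fun t ht => stub_ghostBridge t (stub_ghostFree t ht)

-- `stub_assemble` (lead) LANDED: Theorems/LeeYangFibresFibreHyperbolicityAssemble.lean (p88012), imported.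

/-! ## Composition -/

/-- The cell model law at every `t ≥ 1`, uniformly through the ghost-free law (`ghostFree_all`: `t = 1` landed, `t ≥ 2` the stub). -/
theorem cellModelLaw_of_stubs (t : ℕ) (ht : 1 ≤ t) : CellModelLaw t :=
  stub_ghostBridge t (ghostFree_all stub_ghostFree t ht)

/-- The `t = 1` case of the crux from the PARITY-FREE landed stubs only (no `stub_ghostFree`, no `stub_ghostFreeOne`):
landed verbatim as `fibreHyperbolicityAt_one` / `fibreHyperbolicity_one` in `Theorems/LeeYangFibresFibreHyperbolicityAtOne.lean`
(p90926); kept here under a skeleton-local name. -/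
theorem fibreHyperbolicityAt_one_skel : FHAt 1 :=
  stub_assemble 1 le_rfl stub_perturb stub_coeffBound fibreExpand
    (stub_lawOneNorm (stub_lawOneAnalytic stub_apCells))

/-- **The crux from the stubs**, concluded BY NAME. -/
theorem FibreHyperbolicity_of : FibreHyperbolicity :=
  crux_iff.mpr fun t ht =>
    stub_assemble t ht stub_perturb stub_coeffBound fibreExpand (cellModelLaw_of_stubs t ht)

/-- **What the last open stub carries** (v6): besides the crux, a proof of `stub_ghostFree` would prove crux 3, the
route's cell-level output and its `d = 1` output — the line's residue is not an input of the route but contains its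
output (recorded for the planners; the four implications are the registered residue statements, proved in the tree). -/
theorem residue_carries_route :
    Summit.Parity.GeneralizedHardyLittlewood.Theses.LeeYangFibres.CellParityLaw ∧
    Summit.Parity.GeneralizedHardyLittlewood.Theses.LeeYangFibres.PrimeCellsRelative ∧
    Summit.Parity.GeneralizedHardyLittlewood.Theses.LeeYangFibres.RelativeDimOne :=
  ⟨stub_residueLaw stub_ghostFree, stub_residueCells stub_ghostFree, stub_residueDimOne stub_ghostFree⟩

end Summit.Parity.GeneralizedHardyLittlewood.Cruxes.FibreHyperbolicity.ModelTransfer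

end
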